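import Summits.CriticalPhenomena.Ising3DConformalLimit.Theses.AnomalousForcesInteraction
import Literature.Probability.LatticeModels.CriticalTwoPointLower
import Literature.Probability.LatticeModels.SharpnessProofs
import Literature.Probability.LatticeModels.MagnetizationExponentUpper
import Literature.Probability.LatticeModels.GKSInequalities
import Literature.Probability.LatticeModels.MessagerMiracleSole
import Literature.Probability.LatticeModels.TwoPointSupNormMonotone
import Summits.CriticalPhenomena.Ising3DConformalLimit.Theorems.PerfectScreeningCoulombImpliesNontrivialSusceptibilityOfIsotherm

/-!
# Birth skeleton for crux `EtaPositive` (stmt-CriticalPhenomena-2600) — "η(3) > 0 from the critical isotherm"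

Route `AnomalousForcesInteraction` (Ising3DConformalLimit), crux (AP):
`EtaPositive := ∃ κ C, 0 < κ ∧ ∀ x ≠ 0, ⟨σ₀σ_x⟩⁺_{β_c(3)} ≤ C ‖x‖^{-(1+κ)}`.

LINE (field direction; an effective Buckingham–Gunton/Fisher exponent inequality `2 - η ≤ d(δ-1)/(δ+1)`,
read contrapositively as "`1/δ > 1/5` in upper-bound form forces `η > 0` in upper-bound form"):

* `stub_boxResponse` — FINITE-BOX FLUCTUATION–RESPONSE AT `β_c` IN A FIELD (GHS + GKS + MMS; LANDED p145276 as
  `Theorems/AnomalousForcesInteractionEtaPositiveBoxResponse.lean`; proof repeated inline below): for `h > 0`, `R : ℕ` and `3R ≤ ‖x‖_∞`,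
  `(2R+1)³ · (⟨σ₀σ_x⟩_{β_c} - m(β_c,h)²) ≤ m(β_c,h)/(β_c h)`.
  Proof sketch: `Σ_{y ∈ box R} (⟨σ₀σ_y⟩⁺_{β_c,h} - m²) ≤ m/(β_c h)` is the weak GHS susceptibility bound
  (chord of the concave `s ↦ ⟨σ₀⟩⁺_{Λ,s}`, positivity of truncated correlations, plus boxes `↑ ℤ³`; landed as
  `PerfectScreeningCoulombImpliesNontrivial.sum_plusTrunc_le_mag_div`); `⟨σ₀σ_y⟩⁺_{β_c,h} ≥ ⟨σ₀σ_y⟩⁺_{β_c,0}`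
  (GKS II in the field, `plusCorr_mono_params`); `⟨σ₀σ_y⟩_{β_c} ≥ ⟨σ₀σ_x⟩_{β_c}` for `3‖y‖_∞ ≤ ‖x‖_∞`
  (Messager–Miracle-Solé, `twoPointFree_le_of_mul_supNorm_le` + `twoPointPlus_criticalBeta_eq_twoPointFree_holds`);
  `|box R| = (2R+1)³`.
* `stub_isothermGain` — THE OPEN HEART, the crux moved to the ONE-point function in a field: the upper critical
  isotherm with an exponent strictly above the canonical (`η = 0`) value `1/5`:
  `∃ b > 1/5, A, h₀ > 0, ∀ h ∈ (0,h₀], m(β_c(3),h) ≤ A h^b` (conjecturally `1/δ = 0.2088…`; the mean-field bound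
  `δ ≥ 3` of Aizenman–Barsky–Fernández caps an admissible `b` at `1/3`). Nearest tree object: the residual S6 of
  crux `CoulombImpliesNontrivial` (route PerfectScreening), the same bound with `b = 1/5` exactly, itself reduced
  to a one-arm bound (`stub_isothermOfOneArm`) and to a field-susceptibility bound (`stub_upperIsothermOfSusceptibility`).
* `etaPositive_of_boxResponse_isothermGain` (hypothesis form, sorry-free) and `EtaPositive_of` (the two
  declared stubs fed in; concludes the crux BY NAME) — the composition, a REAL proof: for `‖x‖ ≥ N₀` take `h := ‖x‖^{-3/(b+1)}` and
  `R := ⌊‖x‖/3⌋`, so `(‖x‖³/27)(G(x) - A²h^{2b}) ≤ A h^{b-1}/β_c`, i.e.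
  `G(x) ≤ (A² + 27A/β_c) ‖x‖^{-6b/(b+1)}` with `6b/(b+1) = 1 + κ`, `κ = (5b-1)/(b+1) > 0`; small `‖x‖` by `G ≤ 1`.

Why this is not the crux in costume: the converse "η > 0 ⇒ 1/δ > 1/5" is the hyperscaling direction
`δ ≤ (5-η)/(1+η)`, open on `ℤ³` and false above `d_c`; only the Buckingham–Gunton direction used here is a
theorem. Why the field direction might be easier: at `h > 0` the critical model is massive (Lebowitz–Penrose),
carries the Lee–Yang / random-current-with-ghost structure and GHS concavity; rigorous two-sided isotherm
technology exists (ABF87 `δ ≥ 3`; Camia–Garban–Newman's planar `δ = 15`; the tree's `stub_lowerCriticalIsotherm`).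
-/

namespace Summit.CriticalPhenomena.Ising3DConformalLimit.Cruxes.EtaPositive.Birth

open Literature.Probability.LatticeModels Finset

/-- **GKS monotonicity in the field for the pair observable** (helper of `stub_boxResponse`; landed verbatim as
`AnomalousForcesInteractionEtaPositive.twoPointPlus_le_plusExpect_spinPair`, p145276): for `β, h ≥ 0` and every
site `y`, `⟨σ₀σ_y⟩⁺_{β,0} ≤ ⟨σ₀σ_y⟩⁺_{β,h}`. -/
theorem twoPointPlus_le_plusExpect_spinPair {d : ℕ} {β h : ℝ} (hβ : 0 ≤ β) (hh : 0 ≤ h)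
    (y : Site d) : twoPointPlus d β y ≤ plusExpect d β h (spinPair 0 y) := by
  by_cases hy : y = 0
  · subst hy
    have h1 : plusExpect d β h (spinPair (0 : Site d) 0) = plusCorr d β h ∅ := by
      rw [plusCorr, spinPair_self]
      exact congrArg _ (funext fun s => (spinProduct_empty s).symm)
    rw [twoPointPlus_zero, h1, plusCorr_empty hβ hh]
  · rw [twoPointPlus_eq_plusCorr β hy, spinPair_eq_spinProduct (Ne.symm hy)]
    change plusCorr d β 0 {0, y} ≤ plusCorr d β h {0, y}
    exact plusCorr_mono_params hβ le_rfl le_rfl hh {0, y}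

/-- **stub_boxResponse** (finite-box fluctuation–response at `β_c(3)` in a field `h > 0`; GHS chord bound +
GKS monotonicity in `h` + Messager–Miracle-Solé domination + `|box R| = (2R+1)³`): for `3R ≤ ‖x‖_∞`,
`(2R+1)³ (⟨σ₀σ_x⟩_{β_c} - m(β_c,h)²) ≤ m(β_c,h)/(β_c h)`. CLOSED — landed verbatim (wave 1, stub-worker) as
`AnomalousForcesInteractionEtaPositive.stub_boxResponse`, `Theorems/AnomalousForcesInteractionEtaPositiveBoxResponse.lean`,
p145276 (2026-08-17); the proof is repeated inline so that this skeleton elaborates before the farm rebuilds. -/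
theorem stub_boxResponse :
    ∀ h : ℝ, 0 < h → ∀ (R : ℕ) (x : Site 3), 3 * (R : ℝ) ≤ ‖x‖ →
      (2 * (R : ℝ) + 1) ^ 3 *
          (criticalTwoPoint 3 x - magnetizationInField 3 (criticalBeta 3) h ^ 2) ≤
        magnetizationInField 3 (criticalBeta 3) h / (criticalBeta 3 * h) := by
  intro h hh R x hx
  have hβ : 0 < criticalBeta 3 := criticalBeta_pos_holds (d := 3) (by norm_num)
  -- Messager–Miracle-Solé averaging over the box `Λ_R`, `3R ≤ ‖x‖_∞`
  have hxR : 3 * R ≤ Site.supNorm x := by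
    rw [Site.norm_eq_supNorm] at hx
    exact_mod_cast hx
  have hMMS : (#(box 3 R) : ℝ) * twoPointPlus 3 (criticalBeta 3) x ≤
      ∑ y ∈ box 3 R, twoPointPlus 3 (criticalBeta 3) y :=
    card_box_mul_twoPointPlus_le_sum_box (d := 3) hβ.le hxR
  -- GKS monotonicity in the field, summed over the box
  have hGKS : ∑ y ∈ box 3 R, twoPointPlus 3 (criticalBeta 3) y ≤
      ∑ y ∈ box 3 R, plusExpect 3 (criticalBeta 3) h (spinPair 0 y) :=
    Finset.sum_le_sum fun y _ => twoPointPlus_le_plusExpect_spinPair hβ.le hh.le y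
  -- weak GHS susceptibility bound in the field
  have hGHS : ∑ y ∈ box 3 R, (plusExpect 3 (criticalBeta 3) h (spinPair 0 y) -
      magnetizationInField 3 (criticalBeta 3) h ^ 2) ≤
      magnetizationInField 3 (criticalBeta 3) h / (criticalBeta 3 * h) :=
    PerfectScreeningCoulombImpliesNontrivial.sum_plusTrunc_le_mag_div (d := 3) hβ hh (box 3 R)
  -- `|Λ_R| = (2R+1)³`
  have hcard : (#(box 3 R) : ℝ) = (2 * (R : ℝ) + 1) ^ 3 := by
    rw [card_box]; push_cast; ring
  have hcrit : criticalTwoPoint 3 x = twoPointPlus 3 (criticalBeta 3) x := rfl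
  rw [Finset.sum_sub_distrib, Finset.sum_const, nsmul_eq_mul, hcard] at hGHS
  rw [hcard] at hMMS
  rw [hcrit, mul_sub]
  linarith

/-- **stub_isothermGain** (OPEN — the ONLY remaining `sorry`; "`1/δ > 1/5` in upper-bound form"): the critical
isotherm of the nearest-neighbour Ising model on `ℤ³` obeys `m(β_c, h) ≤ A h^b` on `(0, h₀]` for SOME exponent
`b > 1/5`. Lead c2 (2026-08-17): crux-sized — see `Cruxes/EtaPositive/PROMOTE.md` (entrance map; it is strictly
stronger than the sibling crux stmt-13885's dead residual `m ≤ A h^{1/5}`). Lead c12: OPEN IN PRINT already for any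
`b > 0` (arXiv:2510.23423 after Thm 1.12); admissible WINDOW `b ∈ (1/5, 1/3]` — the strengthening with threshold `1/3`
is refuted unconditionally (`AnomalousForcesInteractionEtaPositive.not_isothermGain_above_third`,
`isothermGain_exponent_le_third`, `Theorems/AnomalousForcesInteractionEtaPositiveWindow.lean`, p165507); conjecturally
`b = 1/δ ≈ 0.2088`. -/
theorem stub_isothermGain :
    ∃ b A h₀ : ℝ, 1 / 5 < b ∧ 0 < h₀ ∧ ∀ h : ℝ, 0 < h → h ≤ h₀ →
      magnetizationInField 3 (criticalBeta 3) h ≤ A * h ^ b := by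
  sorry

/-- **Composition, hypothesis form** (effective Buckingham–Gunton; sorry-free, standard axioms; LANDED with the
quantitative form `G ≤ C‖x‖^{-6b/(b+1)}` for every `b > 0` as
`Theorems/AnomalousForcesInteractionEtaPositiveReduction.lean`, p145285, registered stub of the same name):
`(statement of stub_boxResponse) → (statement of stub_isothermGain) → (definiens of EtaPositive)`, with
`κ = (5b-1)/(b+1)`. The registered skeleton theorem `EtaPositive_of` below feeds it the two declared stubs and
concludes the route decl BY NAME. -/
theorem etaPositive_of_boxResponse_isothermGain :
    (∀ h : ℝ, 0 < h → ∀ (R : ℕ) (x : Site 3), 3 * (R : ℝ) ≤ ‖x‖ →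
      (2 * (R : ℝ) + 1) ^ 3 *
          (criticalTwoPoint 3 x - magnetizationInField 3 (criticalBeta 3) h ^ 2) ≤
        magnetizationInField 3 (criticalBeta 3) h / (criticalBeta 3 * h)) →
    (∃ b A h₀ : ℝ, 1 / 5 < b ∧ 0 < h₀ ∧ ∀ h : ℝ, 0 < h → h ≤ h₀ →
      magnetizationInField 3 (criticalBeta 3) h ≤ A * h ^ b) →
    ∃ κ C : ℝ, 0 < κ ∧ ∀ x : Site 3, x ≠ 0 → criticalTwoPoint 3 x ≤ C * (‖x‖ : ℝ) ^ (-(1 + κ)) := by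
  intro hBox hIso
  obtain ⟨b, A, h₀, hb, hh₀, hM⟩ := hIso
  -- constants of the model
  have hβ : 0 < criticalBeta 3 := criticalBeta_pos_holds (d := 3) (by norm_num)
  have hβne : criticalBeta 3 ≠ 0 := hβ.ne'
  have hm0 : ∀ h : ℝ, 0 ≤ h → 0 ≤ magnetizationInField 3 (criticalBeta 3) h := fun h hh => by
    rw [magnetizationInField_eq_plusCorr]
    exact plusCorr_nonneg (d := 3) hβ.le hh _
  have hG1 : ∀ x : Site 3, criticalTwoPoint 3 x ≤ 1 := fun x =>
    twoPointPlus_le_one_of_nonneg (criticalBeta_nonneg 3) x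
  -- normalised amplitude `A' ≥ 1`
  set A' : ℝ := max A 1 with hA'def
  have hA'1 : 1 ≤ A' := le_max_right _ _
  have hA'0 : 0 < A' := one_pos.trans_le hA'1
  have hAA' : A ≤ A' := le_max_left _ _
  -- exponents: `κ = (5b-1)/(b+1) > 0`, optimising field exponent `e = 3/(b+1)`
  have hb0 : 0 < b := lt_trans (by norm_num) hb
  have hb1 : 0 < b + 1 := by linarith
  have hb1ne : b + 1 ≠ 0 := hb1.ne'
  set κ : ℝ := (5 * b - 1) / (b + 1) with hκdef
  have hκ0 : 0 < κ := div_pos (by linarith) hb1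
  set e : ℝ := 3 / (b + 1) with hedef
  have he0 : 0 < e := div_pos (by norm_num) hb1
  have hene : e ≠ 0 := he0.ne'
  have h2eb : -e * b + -e * b = -(1 + κ) := by
    rw [hedef, hκdef]; field_simp; ring
  have heb3 : -e * (b - 1) + -(3 : ℝ) = -(1 + κ) := by
    rw [hedef, hκdef]; field_simp; ring
  -- the threshold beyond which the optimising field is admissible (`h ≤ h₀`) and `‖x‖ ≥ 3`
  set N₀ : ℝ := max 3 (h₀ ^ (-(1 / e))) with hN₀def
  have hN₀3 : (3 : ℝ) ≤ N₀ := le_max_left _ _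
  have hN₀0 : 0 < N₀ := lt_of_lt_of_le (by norm_num) hN₀3
  -- the two constants
  set K₁ : ℝ := A' ^ 2 + 27 * A' / criticalBeta 3 with hK₁def
  have hK₁0 : 0 ≤ K₁ := by positivity
  set K₂ : ℝ := N₀ ^ (1 + κ) with hK₂def
  have hK₂0 : 0 ≤ K₂ := Real.rpow_nonneg hN₀0.le _
  refine ⟨κ, K₁ + K₂, hκ0, fun x hx => ?_⟩
  -- `n = ‖x‖ ≥ 1`
  set n : ℝ := ‖x‖ with hndef
  have hn1 : 1 ≤ n := by
    rw [hndef, Site.norm_eq_supNorm]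
    have h0 : Site.supNorm x ≠ 0 := fun h => hx (Site.supNorm_eq_zero_iff.1 h)
    exact_mod_cast Nat.one_le_iff_ne_zero.2 h0
  have hn0 : 0 < n := one_pos.trans_le hn1
  have ht0 : 0 ≤ n ^ (-(1 + κ)) := Real.rpow_nonneg hn0.le _
  by_cases hlarge : N₀ ≤ n
  · -- MAIN CASE: `n ≥ N₀ ≥ 3`; field `h = n^{-e}`, radius `R = ⌊n/3⌋`
    have hn3 : 3 ≤ n := hN₀3.trans hlarge
    set h : ℝ := n ^ (-e) with hhdef
    have hh0 : 0 < h := Real.rpow_pos_of_pos hn0 _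
    have hhne : h ≠ 0 := hh0.ne'
    have hhh₀ : h ≤ h₀ := by
      have hy0 : 0 < h₀ ^ (-(1 / e)) := Real.rpow_pos_of_pos hh₀ _
      have hyn : h₀ ^ (-(1 / e)) ≤ n := (le_max_right _ _).trans hlarge
      have h1 : n ^ (-e) ≤ (h₀ ^ (-(1 / e))) ^ (-e) :=
        Real.rpow_le_rpow_of_nonpos hy0 hyn (by linarith)
      have h2 : (h₀ ^ (-(1 / e))) ^ (-e) = h₀ := by
        rw [← Real.rpow_mul hh₀.le]
        have : -(1 / e) * -e = 1 := by field_simp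
        rw [this, Real.rpow_one]
      rw [hhdef]
      exact h1.trans h2.le
    set R : ℕ := ⌊n / 3⌋₊ with hRdef
    have hR3 : 3 * (R : ℝ) ≤ n := by
      have : (R : ℝ) ≤ n / 3 := Nat.floor_le (by positivity)
      linarith
    have hRbig : n / 3 ≤ 2 * (R : ℝ) + 1 := by
      have : n / 3 < (R : ℝ) + 1 := Nat.lt_floor_add_one (n / 3)
      linarith
    set P : ℝ := (2 * (R : ℝ) + 1) ^ 3 with hPdef
    have hP0 : 0 < P := by positivity
    have hPne : P ≠ 0 := hP0.ne'
    have hPn : n ^ 3 / 27 ≤ P := by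
      have h1 : (n / 3) ^ 3 ≤ (2 * (R : ℝ) + 1) ^ 3 := pow_le_pow_left₀ (by positivity) hRbig 3
      have h2 : (n / 3) ^ 3 = n ^ 3 / 27 := by ring
      rw [hPdef, ← h2]; exact h1
    -- the magnetisation at the optimising field
    set m : ℝ := magnetizationInField 3 (criticalBeta 3) h with hmdef
    have hmnn : 0 ≤ m := hm0 h hh0.le
    have hu0 : 0 < h ^ b := Real.rpow_pos_of_pos hh0 _
    have hmle : m ≤ A' * h ^ b := (hM h hh0 hhh₀).trans (mul_le_mul_of_nonneg_right hAA' hu0.le)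
    have hm2 : m ^ 2 ≤ A' ^ 2 * (h ^ b) ^ 2 := by
      rw [← mul_pow]; exact pow_le_pow_left₀ hmnn hmle 2
    -- the box inequality at `(h, R, x)` and its consequence `G(x) ≤ A'² (h^b)² + T/P`
    have hbox : P * (criticalTwoPoint 3 x - m ^ 2) ≤ m / (criticalBeta 3 * h) := hBox h hh0 R x hR3
    have hrhs : m / (criticalBeta 3 * h) ≤ A' * h ^ b / (criticalBeta 3 * h) :=
      div_le_div_of_nonneg_right hmle (by positivity)
    set T : ℝ := A' * h ^ b / (criticalBeta 3 * h) with hTdef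
    have hT0 : 0 ≤ T := by positivity
    have hPG : P * criticalTwoPoint 3 x ≤ P * (A' ^ 2 * (h ^ b) ^ 2) + T := by
      have h1 := hbox.trans hrhs
      rw [mul_sub] at h1
      have h2 := mul_le_mul_of_nonneg_left hm2 hP0.le
      linarith
    have hG : criticalTwoPoint 3 x ≤ A' ^ 2 * (h ^ b) ^ 2 + T / P := by
      have h3 : criticalTwoPoint 3 x ≤ (P * (A' ^ 2 * (h ^ b) ^ 2) + T) / P := by
        rw [le_div_iff₀ hP0]; linarith
      have h4 : (P * (A' ^ 2 * (h ^ b) ^ 2) + T) / P = A' ^ 2 * (h ^ b) ^ 2 + T / P := by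
        rw [add_div, mul_div_cancel_left₀ _ hPne]
      linarith [h3, h4.le, h4.ge]
    -- `1/P ≤ 27/n³`
    have hPinv : T / P ≤ T * (27 / n ^ 3) := by
      rw [div_eq_mul_inv]
      refine mul_le_mul_of_nonneg_left ?_ hT0
      have := inv_anti₀ (by positivity : 0 < n ^ 3 / 27) hPn
      rwa [inv_div] at this
    -- exponent bookkeeping: everything is a power of `n`
    have hn3' : n ^ 3 = n ^ (3 : ℝ) := by rw [← Real.rpow_natCast]; norm_num
    have hpow1 : (h ^ b) ^ 2 = n ^ (-(1 + κ)) := by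
      rw [hhdef, ← Real.rpow_mul hn0.le, sq, ← Real.rpow_add hn0, h2eb]
    have hpow2 : h ^ b / (criticalBeta 3 * h) * (27 / n ^ 3) = 27 / criticalBeta 3 * n ^ (-(1 + κ)) := by
      have hn3ne : n ^ 3 ≠ 0 := by positivity
      have hA : h ^ b / (criticalBeta 3 * h) * (27 / n ^ 3) =
          27 / criticalBeta 3 * (h ^ b / h * (n ^ 3)⁻¹) := by
        field_simp
      have hB : h ^ b / h = n ^ (-e * (b - 1)) := by
        rw [← Real.rpow_sub_one hhne, hhdef, ← Real.rpow_mul hn0.le]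
      have hC : (n ^ 3)⁻¹ = n ^ (-(3 : ℝ)) := by
        rw [Real.rpow_neg hn0.le, hn3']
      rw [hA, hB, hC, ← Real.rpow_add hn0, heb3]
    have h5 : T * (27 / n ^ 3) = A' * (27 / criticalBeta 3 * n ^ (-(1 + κ))) := by
      rw [hTdef, mul_div_assoc, mul_assoc, hpow2]
    have hmain : criticalTwoPoint 3 x ≤ K₁ * n ^ (-(1 + κ)) := by
      calc criticalTwoPoint 3 x ≤ A' ^ 2 * (h ^ b) ^ 2 + T * (27 / n ^ 3) :=
            hG.trans (add_le_add le_rfl hPinv)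
        _ = A' ^ 2 * n ^ (-(1 + κ)) + A' * (27 / criticalBeta 3 * n ^ (-(1 + κ))) := by rw [hpow1, h5]
        _ = K₁ * n ^ (-(1 + κ)) := by rw [hK₁def]; ring
    calc criticalTwoPoint 3 x ≤ K₁ * n ^ (-(1 + κ)) := hmain
      _ ≤ (K₁ + K₂) * n ^ (-(1 + κ)) := by nlinarith [mul_nonneg hK₂0 ht0]
  · -- SMALL CASE: `n < N₀`; `G ≤ 1 ≤ N₀^{1+κ} n^{-(1+κ)}`
    have hnN : n ≤ N₀ := (not_le.1 hlarge).le
    have h1 : N₀ ^ (-(1 + κ)) ≤ n ^ (-(1 + κ)) :=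
      Real.rpow_le_rpow_of_nonpos hn0 hnN (by linarith)
    have h2 : K₂ * N₀ ^ (-(1 + κ)) = 1 := by
      rw [hK₂def, Real.rpow_neg hN₀0.le, mul_inv_cancel₀ (Real.rpow_pos_of_pos hN₀0 _).ne']
    have h3 : 1 ≤ K₂ * n ^ (-(1 + κ)) :=
      calc (1 : ℝ) = K₂ * N₀ ^ (-(1 + κ)) := h2.symm
        _ ≤ K₂ * n ^ (-(1 + κ)) := mul_le_mul_of_nonneg_left h1 hK₂0
    calc criticalTwoPoint 3 x ≤ 1 := hG1 x
      _ ≤ K₂ * n ^ (-(1 + κ)) := h3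
      _ ≤ (K₁ + K₂) * n ^ (-(1 + κ)) := by nlinarith [mul_nonneg hK₁0 ht0]

/-- **Skeleton theorem (the composition BY NAME).** The crux `EtaPositive` of route
`AnomalousForcesInteraction` from the two declared stubs `stub_boxResponse` and `stub_isothermGain`, through
the sorry-free `etaPositive_of_boxResponse_isothermGain`. -/
theorem EtaPositive_of :
    Summit.CriticalPhenomena.Ising3DConformalLimit.Theses.AnomalousForcesInteraction.EtaPositive :=
  etaPositive_of_boxResponse_isothermGain stub_boxResponse stub_isothermGain

end Summit.CriticalPhenomena.Ising3DConformalLimit.Cruxes.EtaPositive.Birth
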